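import Summits.CriticalPhenomena.PercolationContinuityZ3.Theorems.PercNearOneGluingNoHeavyLowerTailSahiCTCRtLumped
import Summits.CriticalPhenomena.PercolationContinuityZ3.Theorems.PercNearOneGluingNoHeavyLowerTailSahiCTCLumpedVertex
import HarnessLib

/-!
# `NoHeavyLowerTail` (crux stmt-CriticalPhenomena-4575), P3 lane: Θ₁-DOMINATION — `Π·Z_{≤1} ≤ Θ₁·Z` for an up-set `Z`, and "Lemma M":
# `Π·Z_{≤1}·(Θ₁ − X_{≤1}) ≤ Θ₁·(Π − X)·Z` coefficientwise (any family `X`, up-set `Z`)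

Support file (seat `prim-l12-p3`, gen 44; `--supports stmt-CriticalPhenomena-4575`).  Memo
`run/shared/lean/prim/prim-l12/FROM-prim-l12-p3-g44-R3-PEELS.md` §3.6.

The adjacent peel for `R_3` (memo §3) compares `coeff_n R_3(𝒳,𝒵)` with the coefficient of the pair in which the loop `{s}` has been added to `𝒳`; its
`[x_d²]`-slice is the explicit polynomial ★★ of the memo, and in the case where every `s`-set of `𝒵` is an `s`-set of `𝒳` the only block of ★★ that is not
a product of nonnegative generating functions is `Θ₁·(Π − X₁₀)·Z₀₁ − Π·(Z₀₁)_{≤1}·(Θ₁ − (X₁₀)_{≤1})`.  This file proves that block nonnegative: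
* `ind_union_of_disjoint` : `1_{P ∪ T} = 1_P + 1_T` for disjoint `P, T`;
* **`coeff_PiP_mul_small_le_Th1_mul`** : for an up-set `Z`, `coeff_n (Π·GF(Z_{≤1})) ≤ coeff_n (Θ₁·GF(Z))` — an explicit injection of pairs
  `(P, T₁) ↦ (T₁, P)` if `P ∈ Z`, `↦ (∅, P ∪ T₁)` otherwise;
* `gf_eq_small_add_large`, `PiP_sub_Th1_eq` : size splits at `1 / 2`;
* **`coeff_lemmaM_nonneg`** : `0 ≤ coeff_n (Θ₁·(Π − GF X)·GF Z − Π·GF(Z_{≤1})·(Θ₁ − GF(X_{≤1})))`, from the ring identity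
  `Θ₁(Π−X)Z − Π Z_{≤1}(Θ₁−X_{≤1}) = (Π−X)·(Θ₁ Z − Π Z_{≤1}) + Π Z_{≤1}·((Π−Θ₁) − (X − X_{≤1}))` and the two dominations.
Nothing is asserted about the crux.
-/

noncomputable section

open scoped Classical

namespace Summit.CriticalPhenomena.PercolationContinuityZ3.Theorems.SahiCTCForms

open Finset MvPolynomial SahiCTCGenFun

variable {α : Type*} [DecidableEq α] [Fintype α]

omit [Fintype α] in
/-- `1_{P ∪ T} = 1_P + 1_T` for disjoint finsets. [folklore] -/
theorem ind_union_of_disjoint {P T : Finset α} (h : Disjoint P T) : ind (P ∪ T) = ind P + ind T := by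
  ext i
  rw [Finsupp.add_apply, ind_apply, ind_apply, ind_apply]
  by_cases hP : i ∈ P
  · have hT : i ∉ T := disjoint_left.1 h hP
    simp [hP, hT]
  · by_cases hT : i ∈ T <;> simp [hP, hT]

/-! ### `Π·Z_{≤1} ≤ Θ₁·Z` -/

/-- **Θ₁-domination.**  For an up-set `Z`: every coefficient of `Π·GF(Z_{≤1})` is at most the corresponding coefficient of `Θ₁·GF(Z)`
(`Θ₁` = all sets of size `≤ 1`, `Z_{≤1}` = the members of `Z` of size `≤ 1`).  Injection of pairs: `(P,T₁) ↦ (T₁,P)` when `P ∈ Z`, and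
`(P,{u}) ↦ (∅, P ∪ {u})` when `P ∉ Z`. [this work] -/
theorem coeff_PiP_mul_small_le_Th1_mul {Z : Finset (Finset α)} (hZ : IsUpperSet (Z : Set (Finset α))) (n : α →₀ ℕ) :
    (PiP * gf (Z.filter fun S => #S ≤ 1)).coeff n ≤ (Th1 * gf Z).coeff n := by
  unfold PiP Th1 bySize
  rw [coeff_gf_mul_gf, coeff_gf_mul_gf]
  -- the injection
  let f : Finset α × Finset α → Finset α × Finset α := fun PT => if PT.1 ∈ Z then (PT.2, PT.1) else (∅, PT.1 ∪ PT.2)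
  have key : ∀ PT ∈ ((univ.powerset ×ˢ Z.filter fun S => #S ≤ 1).filter fun PS => ind PS.1 + ind PS.2 = n),
      PT.1 ∉ Z → (∃ u, PT.2 = {u}) ∧ Disjoint PT.1 PT.2 := by
    intro PT hPT hP
    obtain ⟨hprod, -⟩ := mem_filter.1 hPT
    obtain ⟨hTZ, hT1⟩ := mem_filter.1 (mem_product.1 hprod).2
    have hne : PT.2 ≠ ∅ := fun h => hP (hZ (empty_subset PT.1) (h ▸ hTZ))
    have hcard : #PT.2 = 1 := by
      have := card_pos.2 (nonempty_iff_ne_empty.2 hne); omega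
    obtain ⟨u, hu⟩ := card_eq_one.1 hcard
    refine ⟨⟨u, hu⟩, disjoint_left.2 fun i hiP hiT => hP ?_⟩
    rw [hu, mem_singleton] at hiT; subst hiT
    exact hZ (singleton_subset_iff.2 hiP) (hu ▸ hTZ)
  refine Nat.cast_le.2 (card_le_card_of_injOn f (fun PT hPT => ?_) (fun PT hPT PT' hPT' hf => ?_))
  · -- maps into the target
    obtain ⟨hprod, hsum⟩ := mem_filter.1 hPT
    obtain ⟨hTZ, hT1⟩ := mem_filter.1 (mem_product.1 hprod).2
    rw [Finset.mem_coe, mem_filter, mem_product, mem_filter, mem_powerset]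
    by_cases hP : PT.1 ∈ Z
    · simp only [f, if_pos hP]
      exact ⟨⟨⟨subset_univ _, hT1⟩, hP⟩, by rw [add_comm]; exact hsum⟩
    · simp only [f, if_neg hP]
      obtain ⟨⟨u, hu⟩, hdisj⟩ := key PT hPT hP
      refine ⟨⟨⟨subset_univ _, by simp⟩, hZ subset_union_right hTZ⟩, ?_⟩
      rw [ind_union_of_disjoint hdisj, ← hsum]
      ext i; simp [ind_apply]
  · -- injective
    by_cases hP : PT.1 ∈ Z <;> by_cases hP' : PT'.1 ∈ Z
    · simp only [f, if_pos hP, if_pos hP', Prod.mk.injEq] at hf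
      exact Prod.ext hf.2 hf.1
    · simp only [f, if_pos hP, if_neg hP', Prod.mk.injEq] at hf
      -- `T₁ = ∅ ∈ Z` forces everything into `Z`
      obtain ⟨hprod, -⟩ := mem_filter.1 hPT
      have h0 : (∅ : Finset α) ∈ Z := hf.1 ▸ (mem_filter.1 (mem_product.1 hprod).2).1
      exact absurd (hZ (empty_subset _) h0) hP'
    · simp only [f, if_neg hP, if_pos hP', Prod.mk.injEq] at hf
      obtain ⟨hprod', -⟩ := mem_filter.1 hPT'
      have h0 : (∅ : Finset α) ∈ Z := hf.1.symm ▸ (mem_filter.1 (mem_product.1 hprod').2).1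
      exact absurd (hZ (empty_subset _) h0) hP
    · simp only [f, if_neg hP, if_neg hP', Prod.mk.injEq, true_and] at hf
      obtain ⟨⟨u, hu⟩, hdisj⟩ := key PT hPT hP
      obtain ⟨⟨u', hu'⟩, hdisj'⟩ := key PT' hPT' hP'
      obtain ⟨hprod', -⟩ := mem_filter.1 hPT'
      have hT'Z : PT'.2 ∈ Z := (mem_filter.1 (mem_product.1 hprod').2).1
      by_cases huu : u = u'
      · subst huu
        have h2 : PT.2 = PT'.2 := by rw [hu, hu']
        have h1 : PT.1 = PT'.1 := by
          have e1 : PT.1 = (PT.1 ∪ PT.2) \ PT.2 := by rw [union_sdiff_right, sdiff_eq_self_of_disjoint hdisj]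
          have e2 : PT'.1 = (PT'.1 ∪ PT'.2) \ PT'.2 := by rw [union_sdiff_right, sdiff_eq_self_of_disjoint hdisj']
          rw [e1, e2, hf, h2]
        exact Prod.ext h1 h2
      · -- `u' ∈ P ∪ {u}` with `u' ≠ u` puts `{u'} ⊆ P`, so `P ∈ Z`: contradiction
        exfalso
        have hu'mem : u' ∈ PT.1 ∪ PT.2 := by rw [hf, hu']; simp
        rw [mem_union, hu, mem_singleton] at hu'mem
        rcases hu'mem with h | h
        · exact hP (hZ (singleton_subset_iff.2 h) (hu' ▸ hT'Z))
        · exact huu h.symm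

/-! ### Lemma M -/

omit [Fintype α] in
/-- Size split of a family at `1 / 2`: `GF(X) = GF(X_{≤1}) + GF(X_{≥2})`. [this work] -/
theorem gf_eq_small_add_large (X : Finset (Finset α)) :
    gf X = gf (X.filter fun S => #S ≤ 1) + gf (X.filter fun S => 2 ≤ #S) := by
  rw [← gf_union]
  · congr 1; ext S; simp only [mem_union, mem_filter]; constructor
    · intro h; by_cases h1 : #S ≤ 1
      · exact Or.inl ⟨h, h1⟩
      · exact Or.inr ⟨h, by omega⟩
    · rintro (⟨h, _⟩ | ⟨h, _⟩) <;> exact h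
  · rw [disjoint_left]; intro S h1 h2; simp only [mem_filter] at h1 h2; omega

/-- `Π − Θ₁ = GF(sets of size ≥ 2)`. [this work] -/
theorem PiP_sub_Th1_eq : (PiP : MvPolynomial α ℤ) - Th1 = gf (bySize (2 ≤ ·) : Finset (Finset α)) := by
  have h := PiP_eq_bySize_lt_add_ge (α := α) 2
  have h1 : (bySize (· < 2) : Finset (Finset α)) = bySize (· ≤ 1) := by
    ext S; simp only [bySize, mem_filter, mem_powerset, subset_univ, true_and]; omega
  rw [h1] at h
  unfold Th1; rw [h]; ring

/-- **LEMMA M** (memo g44 §3.6).  For any family `X` and any up-set `Z`: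
`0 ≤ coeff_n (Θ₁·(Π − GF X)·GF Z − Π·GF(Z_{≤1})·(Θ₁ − GF(X_{≤1})))` — the non-product block of the adjacent peel ★★ is nonnegative. [this work] -/
theorem coeff_lemmaM_nonneg (X : Finset (Finset α)) {Z : Finset (Finset α)} (hZ : IsUpperSet (Z : Set (Finset α))) (n : α →₀ ℕ) :
    0 ≤ (Th1 * (PiP - gf X) * gf Z - PiP * gf (Z.filter fun S => #S ≤ 1) * (Th1 - gf (X.filter fun S => #S ≤ 1))).coeff n := by
  have hid : Th1 * (PiP - gf X) * gf Z - PiP * gf (Z.filter fun S => #S ≤ 1) * (Th1 - gf (X.filter fun S => #S ≤ 1))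
      = (PiP - gf X) * (Th1 * gf Z - PiP * gf (Z.filter fun S => #S ≤ 1))
        + PiP * gf (Z.filter fun S => #S ≤ 1) * ((PiP - Th1) - (gf X - gf (X.filter fun S => #S ≤ 1))) := by ring
  rw [hid, coeff_add]
  have hX : X ⊆ (univ.powerset : Finset (Finset α)) := fun S _ => mem_powerset.2 (subset_univ _)
  have hlarge : (PiP : MvPolynomial α ℤ) - Th1 - (gf X - gf (X.filter fun S => #S ≤ 1))
      = gf (bySize (2 ≤ ·)) - gf (X.filter fun S => 2 ≤ #S) := by
    rw [PiP_sub_Th1_eq, gf_eq_small_add_large X]; ring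
  have hsub : (X.filter fun S => 2 ≤ #S) ⊆ (bySize (2 ≤ ·) : Finset (Finset α)) := fun S hS => by
    simp only [bySize, mem_filter, mem_powerset, subset_univ, true_and]; exact (mem_filter.1 hS).2
  refine add_nonneg ?_ ?_
  · refine coeff_mul_nonneg (coeff_gf_sub_gf_nonneg hX) (fun m => ?_) n
    rw [coeff_sub, sub_nonneg]; exact coeff_PiP_mul_small_le_Th1_mul hZ m
  · rw [hlarge]
    unfold PiP
    exact coeff_mul_nonneg (coeff_mul_nonneg (coeff_gf_nonneg _) (coeff_gf_nonneg _)) (coeff_gf_sub_gf_nonneg hsub) n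

end Summit.CriticalPhenomena.PercolationContinuityZ3.Theorems.SahiCTCForms
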